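import Summits.CriticalPhenomena.PercolationContinuityZ3.Theorems.PercNearOneGluingNoHeavyLowerTailPatternSunflower
import HarnessLib

/-!
# `NoHeavyLowerTail` (stmt-CriticalPhenomena-4575) — certificate machine add-on: HARRIS rows for monotone PATTERN events
# (unions allowed) as checker data

Support file (prover prim-ineq-prove-1, new-inequality factory, prove seat; `--supports stmt-CriticalPhenomena-4575`).
Bookkeeping definitions (`RowSpecP` and its fields) + soundness; no named facts, no sorries.

The Harris rows of `…CertRowsH` take CONJUNCTIONS of connection / separation literals.  The LP lanes' `harris2` family (ttrl
`wf3lp`, prim-lf-7) uses UNION attachment events (`o ~ A := o~a₁ ∨ o~a₂ ∨ o~a₃`, `b ~ S`, `conn(U)`, …), i.e. arbitrary increasing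
events of the five-terminal connection pattern.  Here an event is a Boolean PATTERN TEST `φ : ℕ → Bool` on the `2¹⁰` pair-bit patterns
(`PatternSunflower.PatEvent v φ`), monotonicity is the decidable `PatternSunflower.MonoPat` (closure under bit inclusion on the 52
consistent patterns ⇒ `isUpperSet_patEvent`), and the three Harris shapes become product rows `E₁E₂ ≤ E₃E₄` on cell lists
(`patCells φ = consPatterns.filter φ`, value `μ(PatEvent v φ)` by `linEval_patCells`):
* `RowSpecP.pII φ ψ` (both increasing):  `μ[φ]·μ[ψ] ≤ μ[φ ∧ ψ]·μ[⊤]`   (`prodBernoulli_harris`);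
* `RowSpecP.pDD φ ψ` (both decreasing):  the same                       (`prodBernoulli_harris_lower`);
* `RowSpecP.pID φ ψ` (incr. × decr.):    `μ[φ ∧ ψ]·μ[⊤] ≤ μ[φ]·μ[ψ]`   (`prodBernoulli_harris_upper_lower`);
with `RowSpecP.valid` (the `MonoPat` tests, by `decide`), `RowSpecP.toRow`, and `RowSpecP.holds`: a valid spec yields the product
inequality between the cell sums at the cell law of EVERY weighted graph and EVERY placement `v` (injective or not) — admissible input of
`CertCheck.sound` / `CertCheck.soundG`.  Helpers: `patEvent_and`, `patEvent_not`, `patEvent_true`, `linEval_patCells_true` (`μ[⊤] = 1`).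
-/

noncomputable section

namespace Summit.CriticalPhenomena.PercolationContinuityZ3.Theorems

open MeasureTheory Set Literature.Probability.Percolation
open Literature.Probability.LatticeModels (prodBernoulli prodBernoulli_harris prodBernoulli_harris_lower
  prodBernoulli_harris_upper_lower)
open scoped Classical BigOperators
open PatternCells CertCheck CertCells PatternSunflower

namespace CertCells

variable {n : ℕ}

/-! ## Pattern-event algebra -/

/-- Conjunction of tests is intersection of events. [folklore] -/
theorem patEvent_and (v : Fin 5 → Fin n) (φ ψ : ℕ → Bool) :
    PatEvent v (fun m => φ m && ψ m) = PatEvent v φ ∩ PatEvent v ψ := by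
  ext ω
  obtain ⟨m, hm, hcell⟩ := exists_mem_cell v ω
  simp only [Set.mem_inter_iff, mem_patEvent_iff v _ hm hcell, Bool.and_eq_true]

/-- Negation of a test is the complement event. [folklore] -/
theorem patEvent_not (v : Fin 5 → Fin n) (φ : ℕ → Bool) :
    PatEvent v (fun m => !φ m) = (PatEvent v φ)ᶜ := by
  ext ω
  obtain ⟨m, hm, hcell⟩ := exists_mem_cell v ω
  simp only [Set.mem_compl_iff, mem_patEvent_iff v _ hm hcell, Bool.not_eq_true', Bool.not_eq_true]

/-- The trivial test is the sure event. [folklore] -/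
theorem patEvent_true (v : Fin 5 → Fin n) : PatEvent v (fun _ => true) = Set.univ := by
  ext ω
  obtain ⟨m, hm, hcell⟩ := exists_mem_cell v ω
  simp only [Set.mem_univ, mem_patEvent_iff v _ hm hcell]

/-- The cells of a pattern test (the consistent patterns passing it); same list as `CertCells.patCells` of `…CertRowsSHK`,
re-declared here to keep this file independent of the sunflower add-on. [folklore] -/
def patCells (φ : ℕ → Bool) : List ℕ := consPatterns.filter φ

/-- At the cell law, the `linEval` of `patCells φ` is `μ(PatEvent v φ)`. [folklore] -/
theorem linEval_patCells (μ : Measure (BondConfig (Fin n))) [IsFiniteMeasure μ] (v : Fin 5 → Fin n) (φ : ℕ → Bool) :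
    linEval (fun m => μ.real (Cell v m)) (patCells φ) = μ.real (PatEvent v φ) := by
  rw [measureReal_patEvent, sum_cells_eq_listSum]
  rfl

/-- `μ[⊤] = 1` as a `linEval`. [folklore] -/
theorem linEval_patCells_true (w : Sym2 (Fin n) → unitInterval) (v : Fin 5 → Fin n) :
    linEval (fun m => (prodBernoulli w).real (Cell v m)) (patCells fun _ => true) = 1 := by
  haveI : IsProbabilityMeasure (prodBernoulli w) := inferInstance
  rw [linEval_patCells, patEvent_true, probReal_univ]

/-- An antitone test (its negation is monotone) gives a decreasing event. [folklore] -/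
theorem isLowerSet_patEvent (v : Fin 5 → Fin n) {φ : ℕ → Bool} (hφ : MonoPat (fun m => !φ m) = true) :
    IsLowerSet (PatEvent v φ) := by
  have h := (isUpperSet_patEvent v hφ).compl
  rw [patEvent_not, compl_compl] at h
  exact h

/-! ## Harris rows on pattern events -/

/-- Harris row families on pattern tests. [folklore] -/
inductive RowSpecP where
  /-- two increasing tests: `μ[φ] μ[ψ] ≤ μ[φ ∧ ψ] μ[⊤]` -/
  | pII (φ ψ : ℕ → Bool) (mult : List ℕ) (wt : ℕ)
  /-- two decreasing tests: `μ[φ] μ[ψ] ≤ μ[φ ∧ ψ] μ[⊤]` -/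
  | pDD (φ ψ : ℕ → Bool) (mult : List ℕ) (wt : ℕ)
  /-- an increasing and a decreasing test: `μ[φ ∧ ψ] μ[⊤] ≤ μ[φ] μ[ψ]` -/
  | pID (φ ψ : ℕ → Bool) (mult : List ℕ) (wt : ℕ)

/-- Side conditions (decidable): the required monotonicities on the consistent patterns. [folklore] -/
def RowSpecP.valid : RowSpecP → Bool
  | .pII φ ψ _ _ => MonoPat φ && MonoPat ψ
  | .pDD φ ψ _ _ => MonoPat (fun m => !φ m) && MonoPat (fun m => !ψ m)
  | .pID φ ψ _ _ => MonoPat φ && MonoPat (fun m => !ψ m)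

/-- The product row `E₁E₂ ≤ E₃E₄` of a pattern Harris spec, events as cell lists. [folklore] -/
def RowSpecP.toRow : RowSpecP → Row
  | .pII φ ψ mult wt => ⟨patCells φ, patCells ψ, patCells (fun m => φ m && ψ m), patCells (fun _ => true), mult, wt⟩
  | .pDD φ ψ mult wt => ⟨patCells φ, patCells ψ, patCells (fun m => φ m && ψ m), patCells (fun _ => true), mult, wt⟩
  | .pID φ ψ mult wt => ⟨patCells (fun m => φ m && ψ m), patCells (fun _ => true), patCells φ, patCells ψ, mult, wt⟩

/-- **A valid pattern Harris spec yields a valid product row at the cell law** of every weighted graph and every placement.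
[folklore] -/
theorem RowSpecP.holds (r : RowSpecP) (hr : r.valid = true) (w : Sym2 (Fin n) → unitInterval) (v : Fin 5 → Fin n) :
    let x : ℕ → ℝ := fun m => (prodBernoulli w).real (Cell v m)
    linEval x r.toRow.e1 * linEval x r.toRow.e2 ≤ linEval x r.toRow.e3 * linEval x r.toRow.e4 := by
  intro x
  haveI : IsProbabilityMeasure (prodBernoulli w) := inferInstance
  have h1 : linEval x (patCells fun _ => true) = 1 := linEval_patCells_true w v
  cases r with
  | pII φ ψ mult wt =>
    simp only [RowSpecP.valid, Bool.and_eq_true] at hr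
    simp only [RowSpecP.toRow]
    rw [h1, mul_one]
    simp only [x, linEval_patCells, patEvent_and]
    exact prodBernoulli_harris w (isUpperSet_patEvent v hr.1) (isUpperSet_patEvent v hr.2)
      MeasurableSet.of_discrete MeasurableSet.of_discrete
  | pDD φ ψ mult wt =>
    simp only [RowSpecP.valid, Bool.and_eq_true] at hr
    simp only [RowSpecP.toRow]
    rw [h1, mul_one]
    simp only [x, linEval_patCells, patEvent_and]
    exact prodBernoulli_harris_lower w (isLowerSet_patEvent v hr.1) (isLowerSet_patEvent v hr.2)
      MeasurableSet.of_discrete MeasurableSet.of_discrete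
  | pID φ ψ mult wt =>
    simp only [RowSpecP.valid, Bool.and_eq_true] at hr
    simp only [RowSpecP.toRow]
    rw [h1, mul_one]
    simp only [x, linEval_patCells, patEvent_and]
    exact prodBernoulli_harris_upper_lower w (isUpperSet_patEvent v hr.1) (isLowerSet_patEvent v hr.2)
      MeasurableSet.of_discrete MeasurableSet.of_discrete

/-- All specs of a list valid ⇒ all their rows hold (the `hrows` hypothesis of `CertCheck.sound`). [folklore] -/
theorem RowSpecP.holds_all (rows : List RowSpecP) (hvalid : rows.all RowSpecP.valid = true)
    (w : Sym2 (Fin n) → unitInterval) (v : Fin 5 → Fin n) :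
    ∀ r ∈ rows.map RowSpecP.toRow,
      linEval (fun m => (prodBernoulli w).real (Cell v m)) r.e1 * linEval (fun m => (prodBernoulli w).real (Cell v m)) r.e2 ≤
        linEval (fun m => (prodBernoulli w).real (Cell v m)) r.e3 * linEval (fun m => (prodBernoulli w).real (Cell v m)) r.e4 := by
  intro r hr
  obtain ⟨s, hs, rfl⟩ := List.mem_map.1 hr
  exact RowSpecP.holds s ((List.all_eq_true.1 hvalid) s hs) w v

/-- A worked instance: Harris for the UNION attachment `o ~ A` (`0~1 ∨ 0~2 ∨ 0~3`, pair bits `0,1,2`) and `a₁ ~ b` (bit `6`),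
both increasing: `μ(o~A) μ(a₁~b) ≤ μ(o~A ∧ a₁~b)` (side conditions by `decide`). [folklore] -/
theorem patHarris_example (w : Sym2 (Fin n) → unitInterval) (v : Fin 5 → Fin n) :
    (prodBernoulli w).real (PatEvent v fun m => Nat.testBit m 0 || Nat.testBit m 1 || Nat.testBit m 2) *
        (prodBernoulli w).real (PatEvent v fun m => Nat.testBit m 6) ≤
      (prodBernoulli w).real (PatEvent v fun m => (Nat.testBit m 0 || Nat.testBit m 1 || Nat.testBit m 2) && Nat.testBit m 6) := by
  have h := RowSpecP.holds (.pII (fun m => Nat.testBit m 0 || Nat.testBit m 1 || Nat.testBit m 2) (fun m => Nat.testBit m 6) [] 1)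
    (by decide) w v
  have h1 := linEval_patCells_true w v
  simp only [RowSpecP.toRow] at h
  rw [h1, mul_one] at h
  simpa only [linEval_patCells] using h

end CertCells

end Summit.CriticalPhenomena.PercolationContinuityZ3.Theorems

end
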